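import Mathlib
import Summits.NavierStokesRegularity.NavierStokesRegularity.Theorems.ThreadingFluxHorizonTowerFourthDigitNumerator
import HarnessLib

/-!
# Crux `PoloidalLiouville` (stmt-NavierStokesRegularity-1222), crux idea «horizon-threading-tower» (ns-idea-15):
# THE FOURTH CONE DIGIT, IVb — the `M²`-slot coefficient `K₂₂ ≠ 0` (closed form)

Support file (`--supports stmt-NavierStokesRegularity-1222`, helper; cell `ns-wall-extremal`, width hand ns-wall-eng-3 g7; 0 kit), toward
THM K (`FiniteTowerGcdTwoTwoShellsHorizonTowerZonality`); split out of `…FourthDigitExit` for the gate's elaboration budget.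
★ `fourthDigit_K22_ne_zero`: the digit-4 `M²W`-coefficient `K₂₂` of THM K — written EXACTLY as the exit lemma's bookkeeping sum over the
seven channels of the second-digit identity (scalars `u, κ₁, K_M, z_b` of THM J kept by name, with their defining equations as hypotheses) —
has the closed form
`K₂₂ = 679477248·(4m+7)³(4m+3)(4m+5)·c₁·g₂(n+2)·z_b·g₁g₂·c₀(m−n)(m+2)(n+2)·N₄(m,n)`, `m = k+2`
(the cofactor asked for by the cell critic, crit-1 g8 BATCH #26 PRICE 1; proved in two `ring` stages over the nine recurring linear factors
`q₁ q₂ d₁ d₂ f₁ f₂ h₁ h₂ p_b` kept opaque: `K₂₂ = z_b·Γ·E`, `Γ = c₀c₁g₁g₂²(m+2)(n+2)²`, then `E = 10616832·q₁³d₁f₁(m−n)·N₄`), hence `K₂₂ ≠ 0` for `m < n` by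
`Zonal.fourthDigit_numerator_ne_zero` (`…FourthDigitNumerator`) and the non-vanishing of `c₀, c₁, c_b, g₁, g₂, u, z_b`.

HONEST LABEL: scalar polynomial algebra about one crux idea's typed objects; no Prop of the sketch is closed here; `HorizonTowerZonality`
(general towers), `PoloidalLiouville` (1222) OPEN; NS regularity NOT proved.  [folklore]
-/

-- the summit and its single sub-problem share the name (CONVENTIONS §1)
set_option linter.dupNamespace false

noncomputable section

namespace Summit.NavierStokesRegularity.NavierStokesRegularity.Theorems.PoloidalLiouville.HorizonTower

set_option maxHeartbeats 8000000 in
/-- ★ The digit-4 `M²W`-coefficient `K₂₂` (the exit lemma's bookkeeping sum, verbatim) is non-zero for `k + 2 < n`: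
`K₂₂ = 679477248·(4m+7)³(4m+3)(4m+5)·c₁·g₂(n+2)·z_b·g₁g₂·c₀(m−n)(m+2)(n+2)·N₄(m,n)`, `m = k + 2`. [folklore] -/
theorem fourthDigit_K22_ne_zero {k n : ℕ} (hmn : k + 2 < n) {g₁ g₂ κ₁ u c₀ c₁ cb zb KM : ℝ}
    (hg₁0 : g₁ ≠ 0) (hg₂0 : g₂ ≠ 0) (hc₀0 : c₀ ≠ 0) (hc₁0 : c₁ ≠ 0) (hcb0 : cb ≠ 0) (hu0 : u ≠ 0)
    (hu : u = c₁ * ((8 * ((k + 2 : ℕ) : ℝ) + 14) * (8 * (n : ℝ) + 14)) * (g₂ * ((n : ℝ) + 2)))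
    (hκ₁ : κ₁ = 24 * c₀ * (((k + 2 : ℕ) : ℝ) + 2) * ((n : ℝ) + 2) * (((k + 2 : ℕ) : ℝ) - n) * g₁ * g₂)
    (hKM : KM = u * (8 * (n : ℝ) + 14) * (16 * ((k + 2 : ℕ) : ℝ) + 20) * (16 * (n : ℝ) + 20) * (32 * ((k + 2 : ℕ) : ℝ) * (((k + 2 : ℕ) : ℝ) - 1) * κ₁)
      + c₁ * ((8 * ((k + 2 : ℕ) : ℝ) + 14) * (8 * (n : ℝ) + 14)) * (8 * ((k + 2 : ℕ) : ℝ) + 6) * (16 * ((k + 2 : ℕ) : ℝ) + 20) * (16 * (n : ℝ) + 20)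
        * (4 * (((k + 2 : ℕ) : ℝ) - n) * κ₁ * (-(4 * ((n : ℝ) + 2) * ((n : ℝ) + 1) * g₂)))
      + c₀ * u * (8 * (n : ℝ) + 14) * (8 * ((k + 2 : ℕ) : ℝ) + 6)
        * (-((8 * ((k + 2 : ℕ) : ℝ) + 14) * (((k + 2 : ℕ) : ℝ) + 2) * g₁) * (16 * ((k + 2 : ℕ) : ℝ) + 20)
            * (32 * (-(4 * ((n : ℝ) + 2) * ((n : ℝ) + 1) * g₂)) * (n : ℝ) * ((n : ℝ) - 1))
          + ((8 * (n : ℝ) + 14) * ((n : ℝ) + 2) * g₂) * (16 * (n : ℝ) + 20)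
            * (32 * (-(4 * (((k + 2 : ℕ) : ℝ) + 2) * (((k + 2 : ℕ) : ℝ) + 1) * g₁)) * ((k + 2 : ℕ) : ℝ) * (((k + 2 : ℕ) : ℝ) - 1))
          + (16 * ((k + 2 : ℕ) : ℝ) + 20) * (16 * (n : ℝ) + 20)
            * (4 * (((k + 2 : ℕ) : ℝ) - n) * (-(4 * (((k + 2 : ℕ) : ℝ) + 2) * (((k + 2 : ℕ) : ℝ) + 1) * g₁)) * (-(4 * ((n : ℝ) + 2) * ((n : ℝ) + 1) * g₂)))))
    (hzb : zb = ((8 * ((k + 2 : ℕ) : ℝ) + 14) * (8 * (n : ℝ) + 14)) * cb * u * (8 * (n : ℝ) + 14) * (8 * ((k + 2 : ℕ) : ℝ) + 6)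
      * (16 * ((k + 2 : ℕ) : ℝ) + 20) * (16 * (n : ℝ) + 20) * (g₂ * ((n : ℝ) + 2))) :
          (u * (8 * zb) * (8 * ((k : ℝ) + 2) + 14) * (8 * (n : ℝ) + 14) * (16 * ((k : ℝ) + 2) + 20) * (16 * (n : ℝ) + 20) * (24 * ((k : ℝ) + 2) + 18) *
      (24 * (n : ℝ) + 18) * (8 * (k : ℝ) + 14)) * (-(192 * ((k : ℝ) + 2) * ((k : ℝ) + 1) * (k : ℝ) * ((k : ℝ) - 1) * κ₁)) + c₁ * ((8 * ((k : ℝ) + 2)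
      + 14) * (8 * (n : ℝ) + 14)) * ((8 * zb) * (8 * ((k : ℝ) + 2) + 14) * (16 * (k : ℝ) + 36) * (16 * ((k : ℝ) + 2) + 20) * (24 * ((k : ℝ) + 2) +
      18) * (24 * (n : ℝ) + 18) * (8 * (k : ℝ) + 14)) * (-(16 * (n : ℝ) * ((n : ℝ) - 1) * (2 * (k : ℝ) - (n : ℝ) + 6) * (8 * (k : ℝ) + 22) * (-(4 *
      ((n : ℝ) + 2) * ((n : ℝ) + 1) * g₂)) * κ₁ - 16 * ((k : ℝ) + 2) * ((k : ℝ) + 1) * (2 * (n : ℝ) - (k : ℝ)) * (16 * (n : ℝ) + 20) * (-(4 * ((n :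
      ℝ) + 2) * ((n : ℝ) + 1) * g₂)) * κ₁)) + 192 * c₀ * (8 * ((k : ℝ) + 2) + 14) * ((k : ℝ) + 4) * g₁ * (n : ℝ) * ((n : ℝ) - 1) * ((n : ℝ) - 2) *
      ((n : ℝ) - 3) * (-(4 * ((n : ℝ) + 2) * ((n : ℝ) + 1) * g₂)) * (u * (8 * zb) * (8 * ((k : ℝ) + 2) + 14) * (8 * (n : ℝ) + 14) * (8 * (k : ℝ) +
      22) * (16 * (k : ℝ) + 36) * (16 * ((k : ℝ) + 2) + 20) * (24 * ((k : ℝ) + 2) + 18) * (8 * (k : ℝ) + 14)) - 192 * c₀ * (8 * (n : ℝ) + 14) * ((n :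
      ℝ) + 2) * g₂ * ((k : ℝ) + 2) * ((k : ℝ) + 1) * (k : ℝ) * ((k : ℝ) - 1) * (-(4 * (((k : ℝ) + 2) + 2) * (((k : ℝ) + 2) + 1) * g₁)) * (u * (8 *
      zb) * (8 * ((k : ℝ) + 2) + 14) * (8 * (n : ℝ) + 14) * (8 * (k : ℝ) + 22) * (16 * (k : ℝ) + 36) * (16 * (n : ℝ) + 20) * (24 * (n : ℝ) + 18) * (8
      * (k : ℝ) + 14)) - c₀ * ((8 * ((k : ℝ) + 2) + 14) * (8 * (n : ℝ) + 14)) * (u * (8 * zb) * (8 * (k : ℝ) + 22) * (16 * (k : ℝ) + 36) * (24 * ((k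
      : ℝ) + 2) + 18) * (24 * (n : ℝ) + 18) * (8 * (k : ℝ) + 14)) * (-(4 * (((k : ℝ) + 2) + 2) * (((k : ℝ) + 2) + 1) * g₁)) * (-(4 * ((n : ℝ) + 2) *
      ((n : ℝ) + 1) * g₂)) * (16 * (n : ℝ) * ((n : ℝ) - 1) * (2 * (k : ℝ) - (n : ℝ) + 6) * (16 * ((k : ℝ) + 2) + 20) - 16 * ((k : ℝ) + 2) * ((k : ℝ)
      + 1) * (2 * (n : ℝ) - (k : ℝ)) * (16 * (n : ℝ) + 20)) + (((8 * ((k : ℝ) + 2) + 14) * (8 * (n : ℝ) + 14)) * cb * u * (8 * ((k : ℝ) + 2) + 14) *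
      (8 * (n : ℝ) + 14) * (8 * (k : ℝ) + 22) * (16 * (k : ℝ) + 36) * (16 * ((k : ℝ) + 2) + 20) * (16 * (n : ℝ) + 20) * (24 * ((k : ℝ) + 2) + 18) *
      (24 * (n : ℝ) + 18) * (g₂ * ((n : ℝ) + 2))) * (48 * (k : ℝ) * ((k : ℝ) - 1) * KM) + (((8 * ((k : ℝ) + 2) + 14) * (8 * (n : ℝ) + 14)) * cb * u *
      (8 * ((k : ℝ) + 2) + 14) * (8 * (k : ℝ) + 22) * (16 * (k : ℝ) + 36) * (16 * ((k : ℝ) + 2) + 20) * (16 * (n : ℝ) + 20) * (24 * ((k : ℝ) + 2) +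
      18) * (24 * (n : ℝ) + 18) * (8 * (k : ℝ) + 14)) * (-(4 * ((n : ℝ) + 2) * ((n : ℝ) + 1) * g₂)) * (4 * ((k : ℝ) - 2 * (n : ℝ)) * KM) ≠ 0 := by
  -- the nine recurring linear factors as opaque atoms
  obtain ⟨q1r, hq1r⟩ : ∃ x : ℝ, x = 8 * ((k : ℝ) + 2) + 14 := ⟨_, rfl⟩
  obtain ⟨q2r, hq2r⟩ : ∃ x : ℝ, x = 8 * (n : ℝ) + 14 := ⟨_, rfl⟩
  obtain ⟨d1r, hd1r⟩ : ∃ x : ℝ, x = 8 * (k : ℝ) + 22 := ⟨_, rfl⟩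
  obtain ⟨d2r, hd2r⟩ : ∃ x : ℝ, x = 16 * (k : ℝ) + 36 := ⟨_, rfl⟩
  obtain ⟨f1r, hf1r⟩ : ∃ x : ℝ, x = 16 * ((k : ℝ) + 2) + 20 := ⟨_, rfl⟩
  obtain ⟨f2r, hf2r⟩ : ∃ x : ℝ, x = 16 * (n : ℝ) + 20 := ⟨_, rfl⟩
  obtain ⟨h1r, hh1r⟩ : ∃ x : ℝ, x = 24 * ((k : ℝ) + 2) + 18 := ⟨_, rfl⟩
  obtain ⟨h2r, hh2r⟩ : ∃ x : ℝ, x = 24 * (n : ℝ) + 18 := ⟨_, rfl⟩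
  obtain ⟨pbr, hpbr⟩ : ∃ x : ℝ, x = 8 * (k : ℝ) + 14 := ⟨_, rfl⟩
  obtain ⟨K22, hK22⟩ : ∃ K22 : ℝ, K22 =
      (u * (8 * zb) * (8 * ((k : ℝ) + 2) + 14) * (8 * (n : ℝ) + 14) * (16 * ((k : ℝ) + 2) + 20) * (16 * (n : ℝ) + 20) * (24 * ((k : ℝ) + 2) + 18) *
      (24 * (n : ℝ) + 18) * (8 * (k : ℝ) + 14)) * (-(192 * ((k : ℝ) + 2) * ((k : ℝ) + 1) * (k : ℝ) * ((k : ℝ) - 1) * κ₁)) + c₁ * ((8 * ((k : ℝ) + 2)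
      + 14) * (8 * (n : ℝ) + 14)) * ((8 * zb) * (8 * ((k : ℝ) + 2) + 14) * (16 * (k : ℝ) + 36) * (16 * ((k : ℝ) + 2) + 20) * (24 * ((k : ℝ) + 2) +
      18) * (24 * (n : ℝ) + 18) * (8 * (k : ℝ) + 14)) * (-(16 * (n : ℝ) * ((n : ℝ) - 1) * (2 * (k : ℝ) - (n : ℝ) + 6) * (8 * (k : ℝ) + 22) * (-(4 *
      ((n : ℝ) + 2) * ((n : ℝ) + 1) * g₂)) * κ₁ - 16 * ((k : ℝ) + 2) * ((k : ℝ) + 1) * (2 * (n : ℝ) - (k : ℝ)) * (16 * (n : ℝ) + 20) * (-(4 * ((n :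
      ℝ) + 2) * ((n : ℝ) + 1) * g₂)) * κ₁)) + 192 * c₀ * (8 * ((k : ℝ) + 2) + 14) * ((k : ℝ) + 4) * g₁ * (n : ℝ) * ((n : ℝ) - 1) * ((n : ℝ) - 2) *
      ((n : ℝ) - 3) * (-(4 * ((n : ℝ) + 2) * ((n : ℝ) + 1) * g₂)) * (u * (8 * zb) * (8 * ((k : ℝ) + 2) + 14) * (8 * (n : ℝ) + 14) * (8 * (k : ℝ) +
      22) * (16 * (k : ℝ) + 36) * (16 * ((k : ℝ) + 2) + 20) * (24 * ((k : ℝ) + 2) + 18) * (8 * (k : ℝ) + 14)) - 192 * c₀ * (8 * (n : ℝ) + 14) * ((n :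
      ℝ) + 2) * g₂ * ((k : ℝ) + 2) * ((k : ℝ) + 1) * (k : ℝ) * ((k : ℝ) - 1) * (-(4 * (((k : ℝ) + 2) + 2) * (((k : ℝ) + 2) + 1) * g₁)) * (u * (8 *
      zb) * (8 * ((k : ℝ) + 2) + 14) * (8 * (n : ℝ) + 14) * (8 * (k : ℝ) + 22) * (16 * (k : ℝ) + 36) * (16 * (n : ℝ) + 20) * (24 * (n : ℝ) + 18) * (8
      * (k : ℝ) + 14)) - c₀ * ((8 * ((k : ℝ) + 2) + 14) * (8 * (n : ℝ) + 14)) * (u * (8 * zb) * (8 * (k : ℝ) + 22) * (16 * (k : ℝ) + 36) * (24 * ((k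
      : ℝ) + 2) + 18) * (24 * (n : ℝ) + 18) * (8 * (k : ℝ) + 14)) * (-(4 * (((k : ℝ) + 2) + 2) * (((k : ℝ) + 2) + 1) * g₁)) * (-(4 * ((n : ℝ) + 2) *
      ((n : ℝ) + 1) * g₂)) * (16 * (n : ℝ) * ((n : ℝ) - 1) * (2 * (k : ℝ) - (n : ℝ) + 6) * (16 * ((k : ℝ) + 2) + 20) - 16 * ((k : ℝ) + 2) * ((k : ℝ)
      + 1) * (2 * (n : ℝ) - (k : ℝ)) * (16 * (n : ℝ) + 20)) + (((8 * ((k : ℝ) + 2) + 14) * (8 * (n : ℝ) + 14)) * cb * u * (8 * ((k : ℝ) + 2) + 14) *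
      (8 * (n : ℝ) + 14) * (8 * (k : ℝ) + 22) * (16 * (k : ℝ) + 36) * (16 * ((k : ℝ) + 2) + 20) * (16 * (n : ℝ) + 20) * (24 * ((k : ℝ) + 2) + 18) *
      (24 * (n : ℝ) + 18) * (g₂ * ((n : ℝ) + 2))) * (48 * (k : ℝ) * ((k : ℝ) - 1) * KM) + (((8 * ((k : ℝ) + 2) + 14) * (8 * (n : ℝ) + 14)) * cb * u *
      (8 * ((k : ℝ) + 2) + 14) * (8 * (k : ℝ) + 22) * (16 * (k : ℝ) + 36) * (16 * ((k : ℝ) + 2) + 20) * (16 * (n : ℝ) + 20) * (24 * ((k : ℝ) + 2) +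
      18) * (24 * (n : ℝ) + 18) * (8 * (k : ℝ) + 14)) * (-(4 * ((n : ℝ) + 2) * ((n : ℝ) + 1) * g₂)) * (4 * ((k : ℝ) - 2 * (n : ℝ)) * KM) := ⟨_, rfl⟩
  rw [← hK22]
  have hK22a : K22 =
       (u * (8 * zb) * q1r * q2r * f1r * f2r * h1r * h2r * pbr) * (-(192 * ((k : ℝ) + 2) * ((k : ℝ) + 1) * (k : ℝ) * ((k : ℝ) - 1) * κ₁)) + c₁ * (q1r
      * q2r) * ((8 * zb) * q1r * d2r * f1r * h1r * h2r * pbr) * (-(16 * (n : ℝ) * ((n : ℝ) - 1) * (2 * (k : ℝ) - (n : ℝ) + 6) * d1r * (-(4 * ((n : ℝ)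
      + 2) * ((n : ℝ) + 1) * g₂)) * κ₁ - 16 * ((k : ℝ) + 2) * ((k : ℝ) + 1) * (2 * (n : ℝ) - (k : ℝ)) * f2r * (-(4 * ((n : ℝ) + 2) * ((n : ℝ) + 1) *
      g₂)) * κ₁)) + 192 * c₀ * q1r * ((k : ℝ) + 4) * g₁ * (n : ℝ) * ((n : ℝ) - 1) * ((n : ℝ) - 2) * ((n : ℝ) - 3) * (-(4 * ((n : ℝ) + 2) * ((n : ℝ) +
      1) * g₂)) * (u * (8 * zb) * q1r * q2r * d1r * d2r * f1r * h1r * pbr) - 192 * c₀ * q2r * ((n : ℝ) + 2) * g₂ * ((k : ℝ) + 2) * ((k : ℝ) + 1) * (k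
      : ℝ) * ((k : ℝ) - 1) * (-(4 * (((k : ℝ) + 2) + 2) * (((k : ℝ) + 2) + 1) * g₁)) * (u * (8 * zb) * q1r * q2r * d1r * d2r * f2r * h2r * pbr) - c₀
      * (q1r * q2r) * (u * (8 * zb) * d1r * d2r * h1r * h2r * pbr) * (-(4 * (((k : ℝ) + 2) + 2) * (((k : ℝ) + 2) + 1) * g₁)) * (-(4 * ((n : ℝ) + 2) *
      ((n : ℝ) + 1) * g₂)) * (16 * (n : ℝ) * ((n : ℝ) - 1) * (2 * (k : ℝ) - (n : ℝ) + 6) * f1r - 16 * ((k : ℝ) + 2) * ((k : ℝ) + 1) * (2 * (n : ℝ) -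
      (k : ℝ)) * f2r) + ((q1r * q2r) * cb * u * q1r * q2r * d1r * d2r * f1r * f2r * h1r * h2r * (g₂ * ((n : ℝ) + 2))) * (48 * (k : ℝ) * ((k : ℝ) - 1)
      * KM) + ((q1r * q2r) * cb * u * q1r * d1r * d2r * f1r * f2r * h1r * h2r * pbr) * (-(4 * ((n : ℝ) + 2) * ((n : ℝ) + 1) * g₂)) * (4 * ((k : ℝ) -
      2 * (n : ℝ)) * KM) := by
    rw [hK22, hq1r, hq2r, hd1r, hd2r, hf1r, hf2r, hh1r, hh2r, hpbr]
  -- the scalars of THM J at atom level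
  have hu' : u = c₁ * (q1r * q2r) * (g₂ * ((n : ℝ) + 2)) := by rw [hu, hq1r, hq2r]; push_cast; ring
  have hκ₁' : κ₁ = 24 * c₀ * (((k : ℝ) + 2) + 2) * ((n : ℝ) + 2) * (((k : ℝ) + 2) - n) * g₁ * g₂ := by rw [hκ₁]; push_cast; ring
  obtain ⟨KMa, hKMa⟩ : ∃ x : ℝ, x =
      (768 * ((k : ℝ) + 2) * (((k : ℝ) + 2) - 1) * (((k : ℝ) + 2) - (n : ℝ)) * q2r * f1r * f2r - 384 * (((k : ℝ) + 2) - (n : ℝ)) ^ 2 * ((n : ℝ) + 1)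
      * d1r * f1r * f2r + q2r * d1r * (128 * q1r * f1r * ((n : ℝ) + 1) * (n : ℝ) * ((n : ℝ) - 1) - 128 * q2r * f2r * (((k : ℝ) + 2) + 1) * ((k : ℝ) +
      2) * (((k : ℝ) + 2) - 1) + 64 * f1r * f2r * (((k : ℝ) + 2) - (n : ℝ)) * (((k : ℝ) + 2) + 1) * ((n : ℝ) + 1))) := ⟨_, rfl⟩
  have hKM' : KM = q1r * q2r * (c₀ * c₁ * g₁ * g₂ ^ 2 * (((k : ℝ) + 2) + 2) * ((n : ℝ) + 2) ^ 2) * KMa := by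
    have e : KM = u * q2r * f1r * f2r * (32 * ((k : ℝ) + 2) * (((k : ℝ) + 2) - 1) * κ₁)
        + c₁ * (q1r * q2r) * d1r * f1r * f2r * (4 * (((k : ℝ) + 2) - n) * κ₁ * (-(4 * ((n : ℝ) + 2) * ((n : ℝ) + 1) * g₂)))
        + c₀ * u * q2r * d1r
          * (-(q1r * (((k : ℝ) + 2) + 2) * g₁) * f1r * (32 * (-(4 * ((n : ℝ) + 2) * ((n : ℝ) + 1) * g₂)) * (n : ℝ) * ((n : ℝ) - 1))
            + (q2r * ((n : ℝ) + 2) * g₂) * f2r * (32 * (-(4 * (((k : ℝ) + 2) + 2) * (((k : ℝ) + 2) + 1) * g₁)) * ((k : ℝ) + 2) * (((k : ℝ) + 2) - 1))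
            + f1r * f2r * (4 * (((k : ℝ) + 2) - n) * (-(4 * (((k : ℝ) + 2) + 2) * (((k : ℝ) + 2) + 1) * g₁)) * (-(4 * ((n : ℝ) + 2) * ((n : ℝ) + 1) * g₂)))) := by
      rw [hKM, hq1r, hq2r, hd1r, hf1r, hf2r]; push_cast; ring
    rw [e, hKMa, hu', hκ₁']; ring
  have hzb' : zb = q1r * q2r * cb * u * q2r * d1r * f1r * f2r * (g₂ * ((n : ℝ) + 2)) := by
    rw [hzb, hq1r, hq2r, hd1r, hf1r, hf2r]; push_cast; ring
  -- stage 1 (atoms opaque): `K₂₂ = z_b · Γ · E`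
  obtain ⟨E, hE⟩ : ∃ x : ℝ, x =
      (-36864 * ((k : ℝ) + 2) * ((k : ℝ) + 1) * (k : ℝ) * ((k : ℝ) - 1) * (((k : ℝ) + 2) - (n : ℝ)) * (q1r ^ 2 * q2r ^ 2 * f1r * f2r * h1r * h2r *
      pbr) + 768 * ((n : ℝ) + 1) * (((k : ℝ) + 2) - (n : ℝ)) * (16 * (n : ℝ) * ((n : ℝ) - 1) * (2 * (k : ℝ) - (n : ℝ) + 6) * d1r - 16 * ((k : ℝ) + 2)
      * ((k : ℝ) + 1) * (2 * (n : ℝ) - (k : ℝ)) * f2r) * (q1r ^ 2 * q2r * d2r * f1r * h1r * h2r * pbr) - 6144 * ((n : ℝ) + 1) * (n : ℝ) * ((n : ℝ) -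
      1) * ((n : ℝ) - 2) * ((n : ℝ) - 3) * (q1r ^ 3 * q2r ^ 2 * d1r * d2r * f1r * h1r * pbr) + 6144 * (((k : ℝ) + 2) + 1) * ((k : ℝ) + 2) * ((k : ℝ)
      + 1) * (k : ℝ) * ((k : ℝ) - 1) * (q1r ^ 2 * q2r ^ 3 * d1r * d2r * f2r * h2r * pbr) - 128 * (((k : ℝ) + 2) + 1) * ((n : ℝ) + 1) * (16 * (n : ℝ)
      * ((n : ℝ) - 1) * (2 * (k : ℝ) - (n : ℝ) + 6) * f1r - 16 * ((k : ℝ) + 2) * ((k : ℝ) + 1) * (2 * (n : ℝ) - (k : ℝ)) * f2r) * (q1r ^ 2 * q2r ^ 2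
      * d1r * d2r * h1r * h2r * pbr) + 48 * (k : ℝ) * ((k : ℝ) - 1) * KMa * (q1r ^ 2 * q2r * d2r * h1r * h2r) - 16 * ((n : ℝ) + 1) * ((k : ℝ) - 2 *
      (n : ℝ)) * KMa * (q1r ^ 2 * d2r * h1r * h2r * pbr)) := ⟨_, rfl⟩
  have h1 : K22 = zb * (c₀ * c₁ * g₁ * g₂ ^ 2 * (((k : ℝ) + 2) + 2) * ((n : ℝ) + 2) ^ 2) * E := by
    rw [hE, hK22a, hKM', hκ₁', hzb', hu']; ring
  -- stage 2 (atoms expanded; 59 monomials): `E = 10616832 · q₁³ d₁ f₁ (m − n) · N₄(m,n)`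
  have h2 : E = 10616832 * q1r ^ 3 * d1r * f1r * (((k : ℝ) + 2) - n)
      * (48 * ((k : ℝ) + 2) ^ 4 * (n : ℝ) ^ 2 + 192 * ((k : ℝ) + 2) ^ 3 * (n : ℝ) ^ 3 + 144 * ((k : ℝ) + 2) ^ 2 * (n : ℝ) ^ 4 + 96 * ((k : ℝ) + 2) ^
        4 * (n : ℝ) + 648 * ((k : ℝ) + 2) ^ 3 * (n : ℝ) ^ 2 + 320 * ((k : ℝ) + 2) ^ 2 * (n : ℝ) ^ 3 + 1304 * ((k : ℝ) + 2) * (n : ℝ) ^ 4 + 45 * ((k :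
        ℝ) + 2) ^ 4 + 618 * ((k : ℝ) + 2) ^ 3 * (n : ℝ) - 1425 * ((k : ℝ) + 2) ^ 2 * (n : ℝ) ^ 2 + 7314 * ((k : ℝ) + 2) * (n : ℝ) ^ 3 + 512 * (n : ℝ)
        ^ 4 + 180 * ((k : ℝ) + 2) ^ 3 - 4248 * ((k : ℝ) + 2) ^ 2 * (n : ℝ) + 14496 * ((k : ℝ) + 2) * (n : ℝ) ^ 2 + 2884 * (n : ℝ) ^ 3 - 2680 * ((k :
        ℝ) + 2) ^ 2 + 11948 * ((k : ℝ) + 2) * (n : ℝ) + 5868 * (n : ℝ) ^ 2 + 3480 * ((k : ℝ) + 2) + 5096 * (n : ℝ) + 1600) := by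
    rw [hE, hKMa, hq1r, hq2r, hd1r, hd2r, hf1r, hf2r, hh1r, hh2r, hpbr]; ring
  -- non-vanishing
  have hN4 := Zonal.fourthDigit_numerator_ne_zero hmn
  push_cast at hN4
  have hzb0 : zb ≠ 0 := by
    have h7 : g₂ * ((n : ℝ) + 2) ≠ 0 := mul_ne_zero hg₂0 (by positivity)
    have p1 : q1r ≠ 0 := by rw [hq1r]; positivity
    have p2 : q2r ≠ 0 := by rw [hq2r]; positivity
    have p3 : d1r ≠ 0 := by rw [hd1r]; positivity
    have p4 : f1r ≠ 0 := by rw [hf1r]; positivity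
    have p5 : f2r ≠ 0 := by rw [hf2r]; positivity
    rw [hzb']
    exact mul_ne_zero (mul_ne_zero (mul_ne_zero (mul_ne_zero (mul_ne_zero (mul_ne_zero (mul_ne_zero (mul_ne_zero p1 p2) hcb0) hu0) p2) p3) p4) p5) h7
  have hmn' : ((k : ℝ) + 2) - (n : ℝ) ≠ 0 := by
    have h : ((k : ℝ) + 2) < n := by exact_mod_cast hmn
    exact sub_ne_zero.mpr (ne_of_lt h)
  have hE0 : E ≠ 0 := by
    rw [h2]
    have p1 : q1r ^ 3 ≠ 0 := by rw [hq1r]; positivity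
    have p3 : d1r ≠ 0 := by rw [hd1r]; positivity
    have p4 : f1r ≠ 0 := by rw [hf1r]; positivity
    exact mul_ne_zero (mul_ne_zero (mul_ne_zero (mul_ne_zero (mul_ne_zero (by norm_num) p1) p3) p4) hmn') hN4
  rw [h1]
  have pΓ : c₀ * c₁ * g₁ * g₂ ^ 2 * (((k : ℝ) + 2) + 2) * ((n : ℝ) + 2) ^ 2 ≠ 0 := by
    have a1 : (((k : ℝ) + 2) + 2) ≠ 0 := by positivity
    have a2 : ((n : ℝ) + 2) ^ 2 ≠ 0 := by positivity
    exact mul_ne_zero (mul_ne_zero (mul_ne_zero (mul_ne_zero (mul_ne_zero hc₀0 hc₁0) hg₁0) (pow_ne_zero 2 hg₂0)) a1) a2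
  exact mul_ne_zero (mul_ne_zero hzb0 pΓ) hE0

end Summit.NavierStokesRegularity.NavierStokesRegularity.Theorems.PoloidalLiouville.HorizonTower

end
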